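import Summits.RiemannHypothesis.RiemannHypothesis.Theorems.PfPersistenceDownConeNodal
import HarnessLib

/-!
# PF persistence, pf seat (gen 3) — the ARCHIMEDEAN SIDE: log-kernel dilation law and the prime-free form

Unit `pub-rhpf-pf-g3` of the `pub-rhpf` cell (long-odds MECHANISM SEARCH; **no RH claims**).  Two small
kernel facts behind the cell document `PF.md` §14.14 / §15.3 / §15.4 (labels there: DERIVED resp. DATA):

**§1 Log-kernel dilation law** (the 1-D Fourier-side form of Laptev–Weth, *Spectral properties of the
logarithmic Laplacian*, `LaptevWeth2020` = arXiv:2009.03395, Lemma 2.5: `λ_k(RΩ) = λ_k(Ω) − log R`).  For the quadratic form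
`q(h) = ∫ |h(t)|² log|t| dt` and the `L²`-normalised dilation `h_R(t) = √R · h(Rt)`:
`q(h_R) = q(h) − (log R)·‖h‖²`, `‖h_R‖ = ‖h‖`, hence the Rayleigh quotient of the dilates is
`ρ(R) = ρ(1) − log R` and `dρ/dR = −1/R` EXACTLY, for every fixed profile `h`.  Dictionary: a window
test on `[-a, a]` obtained by dilating a fixed profile on `[-1, 1]` has Fourier transform `(ĝ)_a`, so for
the pure-log model of the archimedean kernel the ground energy obeys `a·(−dε/da) = 1` identically; the
tree's kernel `Re ψ(¼ + it/2) = log|t| − log 2 + O(t⁻²)` replaces `1` by the dilation density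
`⟨t ∂ₜ Re ψ(¼ + it/2)⟩_u` (PF.md §15.3, measured 1.21–1.40 by the observatory's R-PF6 leg; DATA).

**§2 The prime-free form.**  The table with EVERY prime power deleted, `deleteTable univ`, has vanishing
prime term, so its quadratic functional is `polar + archimedean` of `g ⋆ g̃`; by fake seat 4's down-cone
nodal forcing (`delete_sign_change_on_window`) every real window test on which this prime-free form is
negative CHANGES SIGN inside the window — at every `ζ`-positive window, unconditionally at `a ≤ 59/100`
(`weilPositivityOn_59_100`), at every window under RH.  Equivalently a one-signed real window test has
nonnegative prime-free energy there.  (PF.md §15.4: the observatory finds the prime-free even ground state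
nodal from `a ≈ 0.38` on with `ε₁ < 0` from `a ≈ 0.41`; the theorem says the node is FORCED on
`0.41 < a ≤ 0.59` — the primes are load-bearing for `ζ`'s one-signedness there.  DATA + PROVED.)

All statements are elementary; nothing here is a claim about `ζ`.
-/

set_option linter.dupNamespace false

noncomputable section

open MeasureTheory Set Filter Complex
open scoped Real Topology

namespace Summit.RiemannHypothesis.RiemannHypothesis.Theorems.PfPersistenceArchSide

open Literature.NumberTheory.LFunctions
open Summit.RiemannHypothesis.RiemannHypothesis.Theorems.PfPersistenceBarrier
open Summit.RiemannHypothesis.RiemannHypothesis.Theorems.PfPersistenceBarrier.ExplicitDatum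
open Summit.RiemannHypothesis.RiemannHypothesis.Theorems.PfPersistenceDownCone

/-! ## §1 The log-kernel dilation law -/

section LogKernel

variable {h : ℝ → ℂ} {R : ℝ}

/-- `L²`-normalised dilation preserves the norm: `∫ R‖h(Rt)‖² dt = ∫ ‖h‖²` (`R > 0`). [folklore] -/
theorem integral_dilate_normSq (h : ℝ → ℂ) (hR : 0 < R) :
    ∫ t, R * ‖h (R * t)‖ ^ 2 = ∫ s, ‖h s‖ ^ 2 := by
  rw [integral_const_mul, Measure.integral_comp_mul_left (fun s ↦ ‖h s‖ ^ 2) R, abs_inv,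
    abs_of_pos hR, smul_eq_mul, ← mul_assoc, mul_inv_cancel₀ hR.ne', one_mul]

/-- **LOG-KERNEL DILATION LAW** (Laptev–Weth Lemma 2.5 in 1-D Fourier form):
`∫ R‖h(Rt)‖² log|t| dt = ∫ ‖h(s)‖² log|s| ds − log R · ∫ ‖h‖²` for `R > 0`, whenever
`‖h‖² log|·|` and `‖h‖²` are integrable. [cite: LaptevWeth2020, Lemma 2.5] -/
theorem integral_dilate_normSq_mul_log (hR : 0 < R)
    (hlog : Integrable fun s ↦ ‖h s‖ ^ 2 * Real.log |s|) (h2 : Integrable fun s ↦ ‖h s‖ ^ 2) :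
    ∫ t, R * ‖h (R * t)‖ ^ 2 * Real.log |t|
      = (∫ s, ‖h s‖ ^ 2 * Real.log |s|) - Real.log R * ∫ s, ‖h s‖ ^ 2 := by
  have hae : (fun t ↦ R * ‖h (R * t)‖ ^ 2 * Real.log |t|) =ᵐ[volume]
      fun t ↦ (fun s ↦ R * (‖h s‖ ^ 2 * Real.log |s| - Real.log R * ‖h s‖ ^ 2)) (R * t) := by
    have h0 : ({(0 : ℝ)}ᶜ : Set ℝ) ∈ ae (volume : Measure ℝ) :=
      compl_mem_ae_iff.2 (measure_singleton 0)
    filter_upwards [h0] with t ht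
    have ht0 : t ≠ 0 := fun h0' ↦ ht (h0' ▸ Set.mem_singleton _)
    rw [abs_mul, Real.log_mul (abs_pos.2 hR.ne').ne' (abs_pos.2 ht0).ne', abs_of_pos hR]
    ring
  rw [integral_congr_ae hae,
    Measure.integral_comp_mul_left
      (fun s ↦ R * (‖h s‖ ^ 2 * Real.log |s| - Real.log R * ‖h s‖ ^ 2)) R,
    integral_const_mul, integral_sub hlog (h2.const_mul _), integral_const_mul, abs_inv,
    abs_of_pos hR, smul_eq_mul, ← mul_assoc, inv_mul_cancel₀ hR.ne', one_mul]

/-- **Rayleigh form**: the log-kernel Rayleigh quotient of the dilate is the profile's minus `log R`. [folklore] -/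
theorem rayleigh_dilate_log (hR : 0 < R)
    (hlog : Integrable fun s ↦ ‖h s‖ ^ 2 * Real.log |s|) (h2 : Integrable fun s ↦ ‖h s‖ ^ 2)
    (hne : (∫ s, ‖h s‖ ^ 2) ≠ 0) :
    (∫ t, R * ‖h (R * t)‖ ^ 2 * Real.log |t|) / (∫ t, R * ‖h (R * t)‖ ^ 2)
      = (∫ s, ‖h s‖ ^ 2 * Real.log |s|) / (∫ s, ‖h s‖ ^ 2) - Real.log R := by
  rw [integral_dilate_normSq_mul_log hR hlog h2, integral_dilate_normSq h hR]
  field_simp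

/-- **The pure-log edge law is exactly `1`, profile-independently**: `R ↦ ρ(R)` (the log-kernel
Rayleigh quotient of the dilates of a fixed profile) has derivative `−1/R₀` at every `R₀ > 0`, i.e.
`R₀ · (−dρ/dR)(R₀) = 1`. [folklore] -/
theorem hasDerivAt_rayleigh_dilate_log {R₀ : ℝ} (hR₀ : 0 < R₀)
    (hlog : Integrable fun s ↦ ‖h s‖ ^ 2 * Real.log |s|) (h2 : Integrable fun s ↦ ‖h s‖ ^ 2)
    (hne : (∫ s, ‖h s‖ ^ 2) ≠ 0) :
    HasDerivAt (fun R : ℝ ↦ (∫ t, R * ‖h (R * t)‖ ^ 2 * Real.log |t|) / (∫ t, R * ‖h (R * t)‖ ^ 2))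
      (-(1 / R₀)) R₀ := by
  have heq : (fun R : ℝ ↦ (∫ t, R * ‖h (R * t)‖ ^ 2 * Real.log |t|) / (∫ t, R * ‖h (R * t)‖ ^ 2))
      =ᶠ[𝓝 R₀] fun R ↦ (∫ s, ‖h s‖ ^ 2 * Real.log |s|) / (∫ s, ‖h s‖ ^ 2) - Real.log R := by
    filter_upwards [lt_mem_nhds hR₀] with R hR
    exact rayleigh_dilate_log hR hlog h2 hne
  refine HasDerivAt.congr_of_eventuallyEq ?_ heq
  have hl : HasDerivAt (fun R : ℝ ↦ Real.log R) (1 / R₀) R₀ := by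
    rw [one_div]; exact Real.hasDerivAt_log hR₀.ne'
  exact ((hasDerivAt_const R₀ ((∫ s, ‖h s‖ ^ 2 * Real.log |s|) / ∫ s, ‖h s‖ ^ 2)).sub hl).congr_deriv
    (by ring)

/-- Scale form of the same law: `R₀ · (−ρ'(R₀)) = 1`. [folklore] -/
theorem mul_neg_deriv_rayleigh_dilate_log {R₀ : ℝ} (hR₀ : 0 < R₀)
    (hlog : Integrable fun s ↦ ‖h s‖ ^ 2 * Real.log |s|) (h2 : Integrable fun s ↦ ‖h s‖ ^ 2)
    (hne : (∫ s, ‖h s‖ ^ 2) ≠ 0) :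
    R₀ * -deriv (fun R : ℝ ↦ (∫ t, R * ‖h (R * t)‖ ^ 2 * Real.log |t|) / (∫ t, R * ‖h (R * t)‖ ^ 2)) R₀
      = 1 := by
  rw [(hasDerivAt_rayleigh_dilate_log hR₀ hlog h2 hne).deriv]
  field_simp

end LogKernel

/-! ## §2 The prime-free form (`deleteTable univ`): polar + archimedean, and nodal forcing for it -/

section PrimeFree

variable {a : ℝ}

/-- Deleting every prime power kills the prime term. [folklore] -/
theorem primeTerm_deleteTable_univ (k : ℝ → ℂ) :
    (tableDatum (deleteTable Set.univ)).primeTerm k = 0 := by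
  unfold ExplicitDatum.primeTerm
  simp [tableDatum, deleteTable]

/-- **The prime-free quadratic functional is `polar + archimedean` of `g ⋆ g̃`.** [folklore] -/
theorem quadratic_deleteTable_univ (g : ℝ → ℂ) :
    (tableDatum (deleteTable Set.univ)).quadratic g
      = weilPolarTerm (weilConv g (weilReflect g)) + weilArchTerm (weilConv g (weilReflect g)) := by
  unfold ExplicitDatum.quadratic ExplicitDatum.functional
  rw [primeTerm_deleteTable_univ, sub_zero]
  rfl

/-- The prime-free energy of a test `g`: `Re (polar + archimedean)(g ⋆ g̃)`. [folklore] -/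
def primeFreeEnergy (g : ℝ → ℂ) : ℝ :=
  (weilPolarTerm (weilConv g (weilReflect g)) + weilArchTerm (weilConv g (weilReflect g))).re

/-- The prime-free energy is the real part of the `deleteTable univ` quadratic functional. [folklore] -/
theorem primeFreeEnergy_eq (g : ℝ → ℂ) :
    primeFreeEnergy g = ((tableDatum (deleteTable Set.univ)).quadratic g).re := by
  rw [quadratic_deleteTable_univ]; rfl

/-- **PRIME-FREE NODAL FORCING at a `ζ`-positive window**: a real window test on `[-a, a]` with negative
prime-free energy takes both signs inside the window. [folklore] -/
theorem primeFree_sign_change_on_window (hpos : WeilPositivityOn a) {f : ℝ → ℝ}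
    (hg : IsWeilTest fun t ↦ (f t : ℂ)) (hsupp : tsupport (fun t ↦ (f t : ℂ)) ⊆ Icc (-a) a)
    (hneg : primeFreeEnergy (fun t ↦ (f t : ℂ)) < 0) :
    (∃ s ∈ Icc (-a) a, f s < 0) ∧ ∃ t ∈ Icc (-a) a, 0 < f t :=
  delete_sign_change_on_window hpos Set.univ hg hsupp (by rwa [← primeFreeEnergy_eq])

/-- **Unconditional instance, `a ≤ 59/100`** (two-prime positivity `weilPositivityOn_59_100` is PROVED in the
tree): every negative direction of the prime-free form changes sign inside the window. [folklore] -/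
theorem primeFree_sign_change_on_window_59_100 (ha : a ≤ 59 / 100) {f : ℝ → ℝ}
    (hg : IsWeilTest fun t ↦ (f t : ℂ)) (hsupp : tsupport (fun t ↦ (f t : ℂ)) ⊆ Icc (-a) a)
    (hneg : primeFreeEnergy (fun t ↦ (f t : ℂ)) < 0) :
    (∃ s ∈ Icc (-a) a, f s < 0) ∧ ∃ t ∈ Icc (-a) a, 0 < f t :=
  primeFree_sign_change_on_window (weilPositivityOn_59_100.mono ha) hg hsupp hneg

/-- Under RH, at every window. [folklore] -/
theorem primeFree_sign_change_on_window_of_riemannHypothesis (hRH : RiemannHypothesis) (a : ℝ)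
    {f : ℝ → ℝ} (hg : IsWeilTest fun t ↦ (f t : ℂ)) (hsupp : tsupport (fun t ↦ (f t : ℂ)) ⊆ Icc (-a) a)
    (hneg : primeFreeEnergy (fun t ↦ (f t : ℂ)) < 0) :
    (∃ s ∈ Icc (-a) a, f s < 0) ∧ ∃ t ∈ Icc (-a) a, 0 < f t :=
  primeFree_sign_change_on_window (fun g hg' _ ↦ weil_criterion_holds.1 hRH g hg') hg hsupp hneg

/-- **Contrapositive (the form PF.md §15.4 uses): at a `ζ`-positive window a ONE-SIGNED real window test has
nonnegative prime-free energy** — so wherever the prime-free ground energy is negative, its ground state is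
nodal: the primes are load-bearing for one-signedness there. [folklore] -/
theorem primeFreeEnergy_nonneg_of_oneSigned (hpos : WeilPositivityOn a) {f : ℝ → ℝ}
    (hg : IsWeilTest fun t ↦ (f t : ℂ)) (hsupp : tsupport (fun t ↦ (f t : ℂ)) ⊆ Icc (-a) a)
    (hone : (∀ t ∈ Icc (-a) a, 0 ≤ f t) ∨ ∀ t ∈ Icc (-a) a, f t ≤ 0) :
    0 ≤ primeFreeEnergy (fun t ↦ (f t : ℂ)) := by
  by_contra hlt
  obtain ⟨⟨s, hs, hfs⟩, ⟨t, ht, hft⟩⟩ := primeFree_sign_change_on_window hpos hg hsupp (not_le.1 hlt)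
  rcases hone with hnn | hnp
  · exact absurd hfs (not_lt.2 (hnn s hs))
  · exact absurd hft (not_lt.2 (hnp t ht))

/-- Unconditional contrapositive on `a ≤ 59/100`. [folklore] -/
theorem primeFreeEnergy_nonneg_of_oneSigned_59_100 (ha : a ≤ 59 / 100) {f : ℝ → ℝ}
    (hg : IsWeilTest fun t ↦ (f t : ℂ)) (hsupp : tsupport (fun t ↦ (f t : ℂ)) ⊆ Icc (-a) a)
    (hone : (∀ t ∈ Icc (-a) a, 0 ≤ f t) ∨ ∀ t ∈ Icc (-a) a, f t ≤ 0) :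
    0 ≤ primeFreeEnergy (fun t ↦ (f t : ℂ)) :=
  primeFreeEnergy_nonneg_of_oneSigned (weilPositivityOn_59_100.mono ha) hg hsupp hone

end PrimeFree

end Summit.RiemannHypothesis.RiemannHypothesis.Theorems.PfPersistenceArchSide

end
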